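import Summits.QuantumFields.YangMills.Theorems.PoincareLipschitzHistoryTailOfTangentMapFact
import Summits.QuantumFields.YangMills.Theorems.PoincareLipschitzMeanDeviationOfSecondMoment
import HarnessLib

/-!
# Crux `HistoryTailL` (stmt-QuantumFields-19936) — FILE K-14: the K2-LANE FACE v10 «THE FIRST-MOMENT ROW IS ONE VARIANCE STATEMENT»
# (secondary face of record, ★★OWNER RULING №28; display of record = the one-row sandwich face ✓p729779)

Cell `ym3-torus` (YM ladder rung R3 = continuum SU(2) Yang–Mills on T³ — a RUNG, NOT the Clay problem: not d = 4, not infinite volume, not a mass gap);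
LEAD seat `ym-ust-19936-w1` g10.  Helper `--supports stmt-QuantumFields-19936`; THEOREMS ONLY; two one-line instantiations of the K2-lane face v9 ✓p731178
`historyTailL_of_tangentMapFact_quantile (hK1)(hT)(hQ)` ∕ `…_of_tangentMapFact (hK1)(hT)(hM)` at px9 g9's (Q2M) suppliers
✓`PoincareLipschitzMeanDeviationOfSecondMoment.quantileDeviation_of_secondMoment (hSM) : (Q)` and `meanDeviationL_of_secondMoment (hSM) : MeanDeviationL`
(Chebyshev ∕ AM–GM with the `p(g)²` room; ideator ym-r3-idea-2 g15's LINE 28 pointer «BlockSecondMomentL»).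

THE DISPLAYED BINDERS (v10).  `hK1` = K1-exp (crux stmt-QuantumFields-23532's exponential letter, VERBATIM since v2); `hT : Literature.Analysis.PDE.MinimisingTangentMapConstant`
[Schoen–Uhlenbeck 1984, Prop. 1.2] — the one named print fact of the continuum face; `hSM` = «BlockSecondMomentL» (ideator g15's all-scales text VERBATIM = px9's
binder): for every `L` a constant `C` and `γ₁` with `∫ dist₁(plaqHol(Ū^j U) a)² d gibbsK ≤ C·(γ·(F.L)⁻¹^(K−j))` at every depth `1 ≤ j ≤ K` — the Gaussian
size of the block-plaquette fluctuation, which implies the crux `MeanDeviationL` (23083) AND the quantile row (Q).  Census v9 → v10: removed [hQ] · added [hSM] ·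
changed [].  HONEST LABEL (★★OWNER WORD 34): unlike v9's `hQ` (a REGISTRY row, 23133's `stub_quantileDeviation`), `hSM` is an OPEN, UNREGISTERED
statement — the Gaussian-size second-moment bound `C·g²_{K−j}` for block plaquettes at all scales (the perturbative expectation; Bałaban-class, NOT printed
as a theorem, NOT a Literature citation) — and it is STRONGER than (Q) and than the crux `MeanDeviationL` (both follow from it by px9 g9's ✓ theorems); if a
lane works on `hSM` itself the clean move is to REGISTER it as an item so this row is a registry row again.  NOTHING of K1-exp, the fact or `hSM` is proved
here; `HistoryTailL` is NOT proved.

WHAT IS PROVED (ns `…Theorems.PoincareLipschitzHistoryTailOfSecondMoment`).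
* ★★★ `historyTailL_of_tangentMapFact_secondMoment (hK1) (hT) (hSM) : UnitScaleTilt.HistoryTailL` — via the quantile door.
* ★★ `historyTailL_of_tangentMapFact_secondMoment' (hK1) (hT) (hSM) : UnitScaleTilt.HistoryTailL` — via `MeanDeviationL` (the crux's own row), same face.
HONEST SCOPE.  Instantiations by landed names only; YM₃ on T³ is rung R3, not Clay; YM gap NOT proved.

References: T. Bałaban, CMP 102 (1985) 255–275 [Balaban1985UV3] ((7) p.257, (71) p.273); R. Schoen, K. Uhlenbeck, Invent. Math. 78 (1984) [SchoenUhlenbeck1984].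
-/

set_option autoImplicit false

noncomputable section

namespace Summit.QuantumFields.YangMills.Theorems.PoincareLipschitzHistoryTailOfSecondMoment

open MeasureTheory Filter Topology Finset Metric
open scoped BigOperators
open Literature.Analysis.FunctionSpaces
open Literature.Analysis.PDE (MinimisingTangentMapConstant)
open Literature.MathematicalPhysics.QuantumFieldTheory.Balaban1983to89
open Literature.MathematicalPhysics.QuantumFieldTheory.Balaban1983to89.T3ContinuumYM3Torus
open Literature.MathematicalPhysics.QuantumFieldTheory.Balaban1983to89.T3UnitScaleTilt
open Literature.MathematicalPhysics.QuantumFieldTheory.Balaban1983to89.T3UnitLawDensityEML (ℰp)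
open Summit.QuantumFields.YangMills.Theorems.PoincareLipschitzHistoryTailOfTangentMapFact (historyTailL_of_tangentMapFact_quantile historyTailL_of_tangentMapFact)
open Summit.QuantumFields.YangMills.Theorems.PoincareLipschitzMeanDeviationOfSecondMoment (quantileDeviation_of_secondMoment meanDeviationL_of_secondMoment)

/-- ★★★ **THE K2-LANE FACE v10: THE CRUX BY NAME FROM K1-exp, THE NAMED FACT `MinimisingTangentMapConstant` AND ONE VARIANCE STATEMENT** (through the
quantile row (Q)). [cite: Balaban1985UV3, (71) p.273; SchoenUhlenbeck1984, Prop. 1.2] -/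
theorem historyTailL_of_tangentMapFact_secondMoment
    (hK1 : ∀ (L : ℕ), ∃ (Cc cc : ℝ), 0 ≤ Cc ∧ 0 < cc ∧ ∃ γ₁ : ℝ, 0 < γ₁ ∧ γ₁ ≤ 1 ∧
      ∀ (F : T3Family) (γ : ℝ), F.L = L → 0 < γ → γ ≤ γ₁ → ∀ (K n : ℕ), 1 ≤ n →
        (n : ℝ) ≤ (F.scheme ℰp γ).β K → 2 * n ≤ (F.P K).sitesPerDir 0 →
        ∀ (x₀ : Site (F.P K) 0) (f : GaugeField (F.P K) 0 (Matrix.specialUnitaryGroup (Fin 2) ℂ) → ℝ) (Λ : ℝ), 0 < Λ →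
          Measurable f → GaugeField.GaugeInvariant f →
          (∀ U U' : GaugeField (F.P K) 0 (Matrix.specialUnitaryGroup (Fin 2) ℂ),
            (∀ b : PBond (F.P K) 0, (∀ k, (b.src k - x₀ k).val < n) → (∀ k, (b.tgt k - x₀ k).val < n) → U b = U' b) →
              f U = f U') →
          (∀ U U' : GaugeField (F.P K) 0 (Matrix.specialUnitaryGroup (Fin 2) ℂ),
            |f U - f U'| ≤ Λ * Real.sqrt (∑ b : PBond (F.P K) 0, GaugeGroup.dist1 (U b * (U' b)⁻¹) ^ 2)) →
          ∀ r : ℝ, 0 ≤ r →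
            (gibbsK F ℰp γ K).real {U | r ≤ f U - ∫ V, f V ∂(gibbsK F ℰp γ K)} ≤
              Cc * Real.exp (-(cc * Real.sqrt ((F.scheme ℰp γ).β K) * r / ((n : ℝ) * Λ))))
    (hT : MinimisingTangentMapConstant)
    (hSM : ∀ (L : ℕ), ∃ C : ℝ, 0 ≤ C ∧ ∃ γ₁ : ℝ, 0 < γ₁ ∧ γ₁ ≤ 1 ∧ ∀ (F : T3Family) (γ : ℝ), F.L = L → 0 < γ → γ ≤ γ₁ →
          ∀ (K j : ℕ), 1 ≤ j → j ≤ K → ∀ a : Plaq (F.P K) j,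
            ∫ U, (GaugeGroup.dist1 (GaugeField.plaqHol (Averaging.iter (fun i' => BlockAveraging.blockAvg (P := F.P K) (j := i') ℰp) j U) a)) ^ 2 ∂(gibbsK F ℰp γ K)
              ≤ C * (γ * ((F.L : ℝ)⁻¹) ^ (K - j)))
    : Summit.QuantumFields.YangMills.Theses.UnitScaleTilt.HistoryTailL :=
  historyTailL_of_tangentMapFact_quantile hK1 hT (quantileDeviation_of_secondMoment hSM)

/-- ★★ **THE SAME FACE THROUGH THE CRUX `MeanDeviationL` (stmt-QuantumFields-23083) INSTEAD OF (Q).** [cite: Balaban1985UV3, (71) p.273; SchoenUhlenbeck1984, Prop. 1.2] -/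
theorem historyTailL_of_tangentMapFact_secondMoment'
    (hK1 : ∀ (L : ℕ), ∃ (Cc cc : ℝ), 0 ≤ Cc ∧ 0 < cc ∧ ∃ γ₁ : ℝ, 0 < γ₁ ∧ γ₁ ≤ 1 ∧
      ∀ (F : T3Family) (γ : ℝ), F.L = L → 0 < γ → γ ≤ γ₁ → ∀ (K n : ℕ), 1 ≤ n →
        (n : ℝ) ≤ (F.scheme ℰp γ).β K → 2 * n ≤ (F.P K).sitesPerDir 0 →
        ∀ (x₀ : Site (F.P K) 0) (f : GaugeField (F.P K) 0 (Matrix.specialUnitaryGroup (Fin 2) ℂ) → ℝ) (Λ : ℝ), 0 < Λ →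
          Measurable f → GaugeField.GaugeInvariant f →
          (∀ U U' : GaugeField (F.P K) 0 (Matrix.specialUnitaryGroup (Fin 2) ℂ),
            (∀ b : PBond (F.P K) 0, (∀ k, (b.src k - x₀ k).val < n) → (∀ k, (b.tgt k - x₀ k).val < n) → U b = U' b) →
              f U = f U') →
          (∀ U U' : GaugeField (F.P K) 0 (Matrix.specialUnitaryGroup (Fin 2) ℂ),
            |f U - f U'| ≤ Λ * Real.sqrt (∑ b : PBond (F.P K) 0, GaugeGroup.dist1 (U b * (U' b)⁻¹) ^ 2)) →
          ∀ r : ℝ, 0 ≤ r →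
            (gibbsK F ℰp γ K).real {U | r ≤ f U - ∫ V, f V ∂(gibbsK F ℰp γ K)} ≤
              Cc * Real.exp (-(cc * Real.sqrt ((F.scheme ℰp γ).β K) * r / ((n : ℝ) * Λ))))
    (hT : MinimisingTangentMapConstant)
    (hSM : ∀ (L : ℕ), ∃ C : ℝ, 0 ≤ C ∧ ∃ γ₁ : ℝ, 0 < γ₁ ∧ γ₁ ≤ 1 ∧ ∀ (F : T3Family) (γ : ℝ), F.L = L → 0 < γ → γ ≤ γ₁ →
          ∀ (K j : ℕ), 1 ≤ j → j ≤ K → ∀ a : Plaq (F.P K) j,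
            ∫ U, (GaugeGroup.dist1 (GaugeField.plaqHol (Averaging.iter (fun i' => BlockAveraging.blockAvg (P := F.P K) (j := i') ℰp) j U) a)) ^ 2 ∂(gibbsK F ℰp γ K)
              ≤ C * (γ * ((F.L : ℝ)⁻¹) ^ (K - j)))
    : Summit.QuantumFields.YangMills.Theses.UnitScaleTilt.HistoryTailL :=
  historyTailL_of_tangentMapFact hK1 hT (meanDeviationL_of_secondMoment hSM)

end Summit.QuantumFields.YangMills.Theorems.PoincareLipschitzHistoryTailOfSecondMoment

end
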